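/-
Copyright (c) 2026 the pub-hodgecm-mathlib formalisation cell (harness21).  Prover seat hodgecm-mathlib-LH4-p03 (g8); LAYER B 3∕3 file F2 of the LH3-p02 (g6) census
`CENSUS-LAYERB-3of3.v1` (4277d501), dealer LH4-plan (g7) WORD #2∕#4∕#6; bottom row of record = LH4-p01 (g6) `CENSUS-F2-TorusDoubleCosetsHKTrace.v1` (43a3f6ef)
reconciled with `MEMO-F2-design.v1` (b9ef5367), 2026-09-02.  Count-neutral base layer of the dyadic (D-UNR) column (FINDINGS #6∕#6′∕#11 of the LH4 board).
-/
import Literature.NumberTheory.Automorphic.UnitaryThreeTorusBlockElementsTrace   -- F1 (LH3-p02): the trace torus literal `M(x,e,y)`, `∈ U`, `∈ Z(c)`, `∈ Z(t)`, `|b| = |σb| = 1`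
import Literature.NumberTheory.Automorphic.UnitaryThreeTorusDoubleCosetsHK        -- ★ Prop. 6 (a) in Flicker's frame: `exists_v_pow_mul_le_one₄` (+ ★ γ0 dictionary, ★ bridge, `flickerKH`)
import HarnessLib

/-!
# Flicker's Proposition 6 (a) for the TRACE-FRAME torus: `H = ⊔_{i ≥ 0} T · diag(ϖ^{−i}, 1, ϖ^{i}) · K_H`, `T = Z_H(t)`, `t = M(x₁,x₂,x₃)` — every residue characteristic
(Flicker (1998), *Elementary proof of the fundamental lemma for a unitary group*, Prop. 6 p. 83, REMARK p. 84)

Topic `NumberTheory/Automorphic`; namespace `Literature.NumberTheory.Automorphic.UnitaryGroup`.  THEOREMS ONLY (no `def`, no instance, no notation, no named fact, no `sorry`).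
Cell `pub/hodgecm-mathlib`, crux H413 = `stmt-HodgeConjecture-24833`; LH4 board (D-UNR), LAYER B 3∕3: row F2 of CENSUS-LAYERB-3of3 4277d501 (LH3-p02 (g6)); bottom row of record
CENSUS-F2 43a3f6ef (LH4-p01 (g6)) §0–§3, MEMO-F2-design b9ef5367 (LH4-p03 (g8)); evidence that the printed values persist at `q = 2^f`: CENSUS-R1 52a4c879 ∕ FINDING #6′ (178∕178
certificate).  The COUNT heads (`rankStrata_counts_of_congr_traceTorusElt{,Pi}`) stay HYPOTHESES of the G-side until LAYER C lands (census §0.4).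

THE TWIN.  ★ `exists_mem_centralizer_mul_diagRadial_mul_mem_flickerKH` proves Prop. 6 (a) for Flicker's equal-diagonal torus `T^θ` under `LocalConjDatum` (`|2| = 1`) and a skew unit
generator `dR` with `IsUnit (2 : R)`.  Here the torus is the TRACE-FRAME torus `T = Z_H(t)`, `t = M(x₁,x₂,x₃) = !![x₁σb + x₃b, 0, π(x₁−x₃); 0, x₂, 0; π′·bσb·(x₁−x₃), 0, x₁b + x₃σb]`
(`b + σb = 1`, `|b| ≤ 1`, `ππ′ = 1`, `π = ϖ^ε`, `ε ≤ 1`, `x₁ ≠ x₃`; F1's literal), the datum is ★ `UnramifiedLocalConjDatum` (every residue characteristic) with the characteristic token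
`(h2 : (2 : K) ≠ 0)` explicit (block shape ∕ ★ γ0 dictionary only), and the bridge generator is any `gR` with `IsUnit (σR gR − gR)` (census tokens T1–T6).  The proof is ★ :77–:263
RE-KEYED with two substitutions (MEMO-F2 (S1)(S2) = CENSUS-F2 (g), parking choice (S1)):
* the dictionary's skew element is `d♯ := b·σb·d`, `d := ι gR − σ(ι gR)` the skew unit of `gR`;
* the MARS generator is `g₁R := bR·(gR − σR gR)` (`ι g₁R = b·d`; `σR g₁R − g₁R = −(gR − σR gR)`, a unit; ring data `g₁σg₁ = −bσb·d²`, `g₁ + σg₁ = d(b − σb)`),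
and then (CENSUS-F2 §1 (P) ∕ MEMO-F2 §1): for the bridge output `z = u + v·bd` the conjugate `A·ι(z)·A⁻¹`, `A = diag(θ∕d♯, 1)`, equals `z·P_ε + σz·(1 − P_ε)` with `P_ε = !![σb, π; π′bσb, b]`
the trace frame's spectral idempotent — so the torus element to peel off is F1's `M(z∕σz, 1, 1)` (WORD #4 normalisation), whose corner reads `!![u∕σz, π·vd∕σz; π′·bσb·vd∕σz,
(u + vd(b−σb))∕σz]`, and the remainder is ★'s `kM` with `d ↦ d♯` and `m := l·σz·ϖ^{i+ε}∕ϖ^N` (`|m| = 1` by ★'s parity count `j = 2i + ε`).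
* **`exists_mem_centralizer_mul_diagRadial_mul_mem_flickerKH_traceTorus`** — the binder `hA` of ★ (F3a) `FixedPointsTorusDoubleCosetCount.natCard_fixedPoints_eq_finsum_relIndex_mul` at
  `G := ↥H`, `T := Z_H(t)` (nesting `Subgroup.centralizer {⟨t, htH⟩}` inside `↥(centralizer {c})` VERBATIM, rider (r-b)), conclusion byte-identical to ★ (T5).
HONEST LABEL: HC_CM is proved only modulo the printed citations (hLiu418 = `stmt-HodgeConjecture-24832`, h413 = `stmt-HodgeConjecture-24833`) until rung 0 closes; structure theory, pays no
organ, opens no road ((D-UNR) stays PRINT by D74′).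

## References
* [Flicker1998UnitaryFL] Y. Z. Flicker, *Elementary proof of the fundamental lemma for a unitary group*, Canad. J. Math. 50 (1998), Prop. 6 p. 83, REMARK p. 84.
* [Rogawski1990] J. D. Rogawski, *Automorphic Representations of Unitary Groups in Three Variables* (1990), §4.9 p. 55.
* [Serre1979] J.-P. Serre, *Local Fields*, GTM 67 (1979), Ch. V §2 (the unramified quadratic ring `𝒪_E = 𝒪_F[g]`, `σg − g` a unit).
-/

set_option autoImplicit false

open Matrix
open scoped MatrixGroups WithZero

namespace Literature.NumberTheory.Automorphic.UnitaryGroup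

open Literature.NumberTheory.Automorphic.HermitianLattice (unitaryInt UnramifiedLocalConjDatum)

section Main

variable {K : Type*} [Field K] [Valued K ℤᵐ⁰] {ϖ : K} (σ : K →+* K) {J : Matrix (Fin 3) (Fin 3) K}
  (hJ : J = (StdForm.antidiagonal 3).over K) (hd : UnramifiedLocalConjDatum σ ϖ)

universe u

set_option maxHeartbeats 1600000 in
-- one long explicit computation (Flicker's Prop. 6 (a) re-keyed to the trace frame); the `field_simp`/`linear_combination` entry identities dominate
include hJ hd in
/-- **FLICKER'S PROPOSITION 6 (a) FOR THE TRACE-FRAME TORUS — `H = ⋃_{i ≥ 0} Z_H(t) · r_i · K_H` at every residue characteristic**, `r_i = diag(ϖ^{−i}, 1, ϖ^{i})`,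
`t = M(x₁,x₂,x₃)` F1's trace literal (`b + σb = 1`, `|b| ≤ 1`, `ππ′ = 1`, `π = ϖ^ε`, `ε ≤ 1`; regularity `x₁ ≠ x₃` is NOT needed for (a)), `K_H = flickerKH`: every `g ∈ H` is `τ · r_i · k` with `τ ∈ Z_H(t)`, `k ∈ K_H`
— the binder `hA` of ★ `FixedPointsTorusDoubleCosetCount` VERBATIM at `G := ↥H`.  PROOF: block shape → ★ γ0 dictionary with the skew unit `d♯ = bσb·d` → scaling and ★ MARS through the
bridge with the generator `g₁ = b·d` (`diag(θ,1)⁻¹g ∝ ι_{g₁}(z)·diag(1,ϖ^j)·k₀`) → PARITY `j = 2i + ε` from `|det corner| = 1` → `τ := M(z∕σz, 1, 1) ∈ Z_H(t)` (F1) → `k := r_i⁻¹τ⁻¹g` with matrix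
`!![mU₀, 0, mU₁∕d♯; 0, e, 0; m·d♯·W₀, 0, mW₁]`, `|m| = |d♯| = 1`, hence integral.  Twin of ★ `exists_mem_centralizer_mul_diagRadial_mul_mem_flickerKH` (`|2| = 1`, Flicker's torus).
[cite: Flicker1998UnitaryFL, Prop. 6 p. 83; REMARK p. 84] -/
theorem exists_mem_centralizer_mul_diagRadial_mul_mem_flickerKH_traceTorus (h2 : (2 : K) ≠ 0)
    {R : Type u} [CommRing R] [IsDomain R] [IsDiscreteValuationRing R] (ι : R →+* K) (hι : Function.Injective ι)
    (hιv : ∀ x : K, Valued.v x ≤ 1 ↔ x ∈ Set.range ι) (σR : R →+* R) (hσR : ∀ r, σR (σR r) = r) (hσι : ∀ r, ι (σR r) = σ (ι r))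
    {gR : R} (hgR : IsUnit (σR gR - gR)) {ϖR : R} (hϖR : Irreducible ϖR) (hιϖ : ι ϖR = ϖ)
    {c : ↥(unitaryGroupOfForm σ J)} (hc : ((c : GL (Fin 3) K) : Matrix (Fin 3) (Fin 3) K) = !![1, 0, 0; 0, -1, 0; 0, 0, 1])
    {π π' : K} {ε : ℕ} (hε : ε ≤ 1) (hπε : π = ϖ ^ ε) (hππ : π * π' = 1)
    {b : K} (hb : b + σ b = 1) (hbv : Valued.v b ≤ 1)
    {t : ↥(unitaryGroupOfForm σ J)} (htH : t ∈ Subgroup.centralizer ({c} : Set ↥(unitaryGroupOfForm σ J))) {x₁ x₂ x₃ : K}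
    (hte : ((t : GL (Fin 3) K) : Matrix (Fin 3) (Fin 3) K) =
      !![x₁ * σ b + x₃ * b, 0, π * (x₁ - x₃); 0, x₂, 0; π' * (b * σ b * (x₁ - x₃)), 0, x₁ * b + x₃ * σ b])
    (r : ℕ → ↥(Subgroup.centralizer ({c} : Set ↥(unitaryGroupOfForm σ J))))
    (hr : ∀ i, (((r i : ↥(unitaryGroupOfForm σ J)) : GL (Fin 3) K) : Matrix (Fin 3) (Fin 3) K) = !![(ϖ ^ i)⁻¹, 0, 0; 0, 1, 0; 0, 0, ϖ ^ i])
    (g : ↥(Subgroup.centralizer ({c} : Set ↥(unitaryGroupOfForm σ J)))) :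
    ∃ i : ℕ, ∃ τ ∈ Subgroup.centralizer ({⟨t, htH⟩} : Set ↥(Subgroup.centralizer ({c} : Set ↥(unitaryGroupOfForm σ J)))),
      ∃ k ∈ (flickerKH σ J c).subgroupOf (Subgroup.centralizer ({c} : Set ↥(unitaryGroupOfForm σ J))), g = τ * r i * k := by
  classical
  -- scalar facts
  have hϖ0 : ϖ ≠ 0 := hd.ϖ_ne_zero
  have hσσ : ∀ z, σ (σ z) = z := hd.σσ
  have hσϖ : σ ϖ = ϖ := hd.σϖ
  have hθ0 : π ≠ 0 := by rw [hπε]; exact pow_ne_zero _ hϖ0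
  have hσπ : σ π = π := by rw [hπε, map_pow, hσϖ]
  have hσθ' : σ π' = π' := by
    have h1 : π' = π⁻¹ := (inv_eq_of_mul_eq_one_right hππ).symm
    rw [h1, map_inv₀, hσπ]
  obtain ⟨hvb, hvσb, hvbb⟩ := v_eq_one_of_add_map_eq_one σ hd.vσ hbv hb
  have hb0 : b ≠ 0 := fun h0 => by rw [h0, map_zero] at hvb; exact zero_ne_one hvb
  have hσb0 : σ b ≠ 0 := fun h0 => by rw [h0, map_zero] at hvσb; exact zero_ne_one hvσb
  have hσbb : σ (σ b) = b := hσσ b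
  -- the skew unit `d := ι gR − σ (ι gR)` and the dictionary skew `d♯ := bσb·d`
  obtain ⟨d, hd_def⟩ : ∃ d : K, d = ι gR - σ (ι gR) := ⟨_, rfl⟩
  have hdK : σ d = -d := by rw [hd_def, map_sub, hσσ]; ring
  have hvd : Valued.v d = 1 := by
    have h1 : Valued.v (ι (σR gR - gR)) = 1 := TorusBridge.v_eq_one_of_isUnit ι hιv hgR
    rw [map_sub, hσι] at h1
    rw [hd_def, ← Valuation.map_neg, neg_sub]; exact h1
  have hd0 : d ≠ 0 := fun h0 => by rw [h0, map_zero] at hvd; exact zero_ne_one hvd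
  obtain ⟨ds, hds_def⟩ : ∃ ds : K, ds = b * σ b * d := ⟨_, rfl⟩
  have hdsK : σ ds = -ds := by rw [hds_def, map_mul, map_mul, hσbb, hdK]; ring
  have hvds : Valued.v ds = 1 := by rw [hds_def, map_mul, hvbb, hvd, one_mul]
  have hds0 : ds ≠ 0 := fun h0 => by rw [h0, map_zero] at hvds; exact zero_ne_one hvds
  -- the MARS generator `g₁R := bR · (gR − σR gR)`, `ι g₁R = b·d`
  obtain ⟨bR, hbR⟩ := (hιv b).1 hbv
  obtain ⟨g₁R, hg₁R_def⟩ : ∃ g₁R : R, g₁R = bR * (gR - σR gR) := ⟨_, rfl⟩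
  have hιg₁ : ι g₁R = b * d := by rw [hg₁R_def, map_mul, hbR, map_sub, hσι, hd_def]
  have hσg₁ : σ (ι g₁R) = -(σ b * d) := by rw [hιg₁, map_mul, hdK]; ring
  have hg₁ : IsUnit (σR g₁R - g₁R) := by
    have hbRσ : σR bR + bR = 1 := hι (by rw [map_add, hσι, hbR, map_one, add_comm]; exact hb)
    have : σR g₁R - g₁R = (σR bR + bR) * (σR gR - gR) := by rw [hg₁R_def, map_mul, map_sub, hσR]; ring
    rw [this, hbRσ, one_mul]; exact hgR
  have hσϖR : σR ϖR = ϖR := hι (by rw [hσι, hιϖ, hσϖ])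
  -- Step 1: block shape and the dictionary (skew element `d♯`)
  obtain ⟨α, β, γ, δ, e, hg⟩ := exists_coe_eq_block_of_mem_centralizer σ h2 hc g.2
  have hg3 : ((g : ↥(unitaryGroupOfForm σ J)) : GL (Fin 3) K) ∈ unitaryGroupOfForm σ ((StdForm.antidiagonal 3).over K) := by
    rw [← hJ]; exact (g : ↥(unitaryGroupOfForm σ J)).2
  obtain ⟨⟨l, hl0, hl, f1, f2, f3, f4, -⟩, he⟩ := SplitDictionary.exists_fixed_coords_of_coe_eq_block σ h2 hdsK hds0 hg3 hg
  have hσl0 : σ l ≠ 0 := fun h0 => hl0 (by rw [← hl, h0, mul_zero])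
  -- Step 2: scale `diag(π,1)⁻¹ g` into the integers and apply MARS through the bridge (generator `g₁R`)
  obtain ⟨N, hN1, hN2, hN3, hN4⟩ := exists_v_pow_mul_le_one₄ hd.vϖ (α / l / π) (ds * β / l / π) (γ / (ds * l)) (δ / l)
  have hσϖN : σ (ϖ ^ N) = ϖ ^ N := by rw [map_pow, hσϖ]
  obtain ⟨u, v, j, U₀, U₁, W₀, W₁, hu, hv, hvu, hvv, hz, hU₀, hU₁, hW₀, hW₁, hvU₀, hvU₁, hvW₀, hvW₁, hvk, E00, E10, E01, E11⟩ :=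
    TorusBridge.exists_coords_eq_iota_diag_pow σ ι hι hιv σR hσι hσR hg₁ hϖR hσϖR
      !![ϖ ^ N * (α / l / π), ϖ ^ N * (ds * β / l / π); ϖ ^ N * (γ / (ds * l)), ϖ ^ N * (δ / l)]
      (by intro a b'; fin_cases a <;> fin_cases b' <;> simp [map_mul, map_div₀, hσϖN, hσπ, f1, f2, f3, f4] )
      (by
        intro a b'
        fin_cases a <;> fin_cases b'
        · exact hN1
        · exact hN2
        · exact hN3
        · exact hN4)
      (by
        simp only [of_apply, cons_val', cons_val_zero, cons_val_one, empty_val', cons_val_fin_one]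
        have hΔ : α * δ - β * γ ≠ 0 := fun h0 => hl0 (by rw [← hl, h0, zero_mul])
        have : ϖ ^ N * (α / l / π) * (ϖ ^ N * (δ / l)) - ϖ ^ N * (ds * β / l / π) * (ϖ ^ N * (γ / (ds * l))) =
            (ϖ ^ N) ^ 2 * (α * δ - β * γ) / (l ^ 2 * π) := by field_simp
        rw [this]
        exact div_ne_zero (mul_ne_zero (pow_ne_zero _ (pow_ne_zero _ hϖ0)) hΔ) (mul_ne_zero (pow_ne_zero _ hl0) hθ0))
  simp only [of_apply, cons_val', cons_val_zero, cons_val_one, empty_val', cons_val_fin_one, hιϖ] at E00 E10 E01 E11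
  rw [hιg₁] at hz
  rw [hσg₁, hιg₁] at E00 E10 E01 E11
  -- the ring data of the generator: `g₁σg₁ = −bσb·d²`, `g₁ + σg₁ = d(b − σb)`
  have hNg : b * d * -(σ b * d) = -(b * σ b * (d * d)) := by ring
  have hTg : b * d + -(σ b * d) = d * (b - σ b) := by ring
  rw [hNg] at E00 E01
  rw [hTg] at E10 E11
  -- Step 3: `z`, `σz`; valuations; `|αδ − βγ| = 1`, parity `j + ε = 2(N + L)`
  obtain ⟨z, hzdef⟩ : ∃ z : K, z = u + v * (b * d) := ⟨_, rfl⟩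
  have hz0 : z ≠ 0 := by rw [hzdef]; exact hz
  obtain ⟨w, hwdef⟩ : ∃ w : K, w = σ z := ⟨_, rfl⟩
  have hw : w = u - v * (σ b * d) := by rw [hwdef, hzdef, map_add, map_mul, hu, hv, map_mul, hdK]; ring
  have hσw : σ w = z := by rw [hwdef, hσσ]
  have hw0 : w ≠ 0 := fun h0 => hz0 (by rw [← hσw, h0, map_zero])
  have hvw : Valued.v w = Valued.v z := by rw [hwdef, hd.vσ]
  have hvl : Valued.v (σ l) = Valued.v l := hd.vσ l
  have hvΔ : Valued.v (α * δ - β * γ) = 1 := by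
    have h1 := congrArg Valued.v hl
    rw [map_mul, hvl] at h1
    have hvl0 : Valued.v l ≠ 0 := (Valuation.ne_zero_iff _).2 hl0
    exact mul_right_cancel₀ hvl0 (by rw [h1, one_mul])
  -- the entries of `g` from the MARS identities
  have hϖN0 : ϖ ^ N ≠ 0 := pow_ne_zero _ hϖ0
  have eα : α = l * π * (u * U₀ + v * (b * σ b * (d * d)) * (ϖ ^ j * W₀)) / ϖ ^ N := by
    have h := E00
    field_simp at h
    rw [eq_div_iff hϖN0]
    linear_combination h
  have eβ : β = l * π * (u * U₁ + v * (b * σ b * (d * d)) * (ϖ ^ j * W₁)) / (ds * ϖ ^ N) := by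
    have h := E01
    field_simp at h
    rw [eq_div_iff (mul_ne_zero hds0 hϖN0)]
    linear_combination h
  have eγ : γ = l * ds * (v * U₀ + (u + v * (d * (b - σ b))) * (ϖ ^ j * W₀)) / ϖ ^ N := by
    have h := E10
    field_simp at h
    rw [eq_div_iff hϖN0]
    linear_combination h
  have eδ : δ = l * (v * U₁ + (u + v * (d * (b - σ b))) * (ϖ ^ j * W₁)) / ϖ ^ N := by
    have h := E11
    field_simp at h
    rw [eq_div_iff hϖN0]
    linear_combination h
  -- the determinant identity (`det ι(z) = z·σz`)
  have hzw : z * w = u * (u + v * (d * (b - σ b))) - v * v * (b * σ b * (d * d)) := by rw [hw, hzdef]; ring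
  have hdetId : (α * δ - β * γ) * (ϖ ^ N) ^ 2 = π * l ^ 2 * ϖ ^ j * (U₀ * W₁ - U₁ * W₀) * (z * w) := by
    rw [eα, eβ, eγ, eδ, hzw]; field_simp; ring
  -- logs
  have hvz0 : Valued.v z ≠ 0 := (Valuation.ne_zero_iff _).2 hz0
  have hvl0 : Valued.v l ≠ 0 := (Valuation.ne_zero_iff _).2 hl0
  have hvk0 : Valued.v (U₀ * W₁ - U₁ * W₀) = 1 := hvk
  have hvθ : Valued.v π = WithZero.exp (-(ε : ℤ)) := by
    rw [hπε, map_pow, hd.vϖ, ← WithZero.exp_nsmul]; simp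
  have hpar : (j : ℤ) + ε = 2 * ((N : ℤ) + WithZero.log (Valued.v l) + WithZero.log (Valued.v z)) := by
    have h1 := congrArg Valued.v hdetId
    rw [map_mul, map_pow, map_pow, hd.vϖ, hvΔ, one_mul, map_mul, map_mul, map_mul, map_mul, map_mul, hvθ, map_pow, map_pow, hd.vϖ, hvk0,
      mul_one, hvw, ← WithZero.exp_log hvl0, ← WithZero.exp_log hvz0] at h1
    simp only [← WithZero.exp_nsmul, ← WithZero.exp_add, WithZero.exp_inj, nsmul_eq_mul] at h1
    push_cast at h1
    linarith
  -- `i := N + L − ε ≥ 0`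
  obtain ⟨i, hi⟩ : ∃ i : ℕ, (j : ℤ) = 2 * i + ε := by
    have hM : (0 : ℤ) ≤ (N : ℤ) + WithZero.log (Valued.v l) + WithZero.log (Valued.v z) - ε := by
      interval_cases ε <;> push_cast at hpar ⊢ <;> omega
    refine ⟨((N : ℤ) + WithZero.log (Valued.v l) + WithZero.log (Valued.v z) - ε).toNat, ?_⟩
    rw [Int.toNat_of_nonneg hM]; omega
  have hjε : j = 2 * i + ε := by exact_mod_cast hi
  -- Step 4: the torus element `τ := M(z∕σz, 1, 1)` (F1's constructor) and its simplified corner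
  have hxn : σ (z / w) * (z / w) = 1 := by rw [map_div₀, hσw, ← hwdef]; field_simp
  obtain ⟨τ, hτ⟩ := exists_coe_eq_traceTorusBlock σ hJ hσσ hb hππ hσπ hσθ' hxn (by rw [map_one, one_mul]) (by rw [map_one, one_mul])
  have hτH : τ ∈ Subgroup.centralizer ({c} : Set ↥(unitaryGroupOfForm σ J)) := traceTorusBlock_mem_centralizer_diag σ hc hτ
  have hτt : τ ∈ Subgroup.centralizer ({t} : Set ↥(unitaryGroupOfForm σ J)) := traceTorusBlock_mem_centralizer σ hb hππ hte hτ
  -- the corner of `M(z∕w, 1, 1)` in `(u, v)` coordinates (uses `b + σb = 1`)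
  have n00 : z * σ b + b * w = u := by rw [hzdef, hw]; linear_combination u * hb
  have n02 : z - w = v * d := by rw [hzdef, hw]; linear_combination (v * d) * hb
  have n22 : z * b + σ b * w = u + v * (d * (b - σ b)) := by rw [hzdef, hw]; linear_combination (u + v * d * (b - σ b)) * hb
  have t00 : z / w * σ b + 1 * b = u / w := by rw [← n00]; field_simp
  have t02 : π * (z / w - 1) = π * (v * d) / w := by rw [← n02]; field_simp
  have t20 : π' * (b * σ b * (z / w - 1)) = π' * (b * σ b * (v * d)) / w := by rw [← n02]; field_simp
  have t22 : z / w * b + 1 * σ b = (u + v * (d * (b - σ b))) / w := by rw [← n22]; field_simp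
  have hτ' : ((τ : GL (Fin 3) K) : Matrix (Fin 3) (Fin 3) K) =
      !![u / w, 0, π * (v * d) / w; 0, 1, 0; π' * (b * σ b * (v * d)) / w, 0, (u + v * (d * (b - σ b))) / w] := by
    rw [hτ, t00, t02, t20, t22]
  -- Step 5: the element `k := r_i⁻¹ τ⁻¹ g` and its matrix
  obtain ⟨m, hm⟩ : ∃ m : K, m = l * w * ϖ ^ (i + ε) / ϖ ^ N := ⟨_, rfl⟩
  have hvm : Valued.v m = 1 := by
    have hjl : WithZero.log (Valued.v l) + WithZero.log (Valued.v z) = (i : ℤ) + ε - N := by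
      have : (j : ℤ) = 2 * i + ε := hi
      linarith
    rw [hm, map_div₀, map_mul, map_mul, map_pow, map_pow, hd.vϖ, hvw, ← WithZero.exp_log hvl0, ← WithZero.exp_log hvz0]
    simp only [← WithZero.exp_nsmul, ← WithZero.exp_add, ← WithZero.exp_sub, nsmul_eq_mul]
    rw [show WithZero.log (Valued.v l) + WithZero.log (Valued.v z) + ((i + ε : ℕ) : ℤ) * -1 - (N : ℤ) * -1 = 0 by
      push_cast; linarith, WithZero.exp_zero]
  let kM : Matrix (Fin 3) (Fin 3) K := !![m * U₀, 0, m * U₁ / ds; 0, e, 0; m * ds * W₀, 0, m * W₁]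
  -- the product identity `τM · rM · kM = gM`
  have hprod : ((τ : GL (Fin 3) K) : Matrix (Fin 3) (Fin 3) K) * (((r i : ↥(unitaryGroupOfForm σ J)) : GL (Fin 3) K) : Matrix (Fin 3) (Fin 3) K) * kM =
      (((g : ↥(unitaryGroupOfForm σ J)) : GL (Fin 3) K) : Matrix (Fin 3) (Fin 3) K) := by
    rw [hτ', hr i, block_mul_block, hg]
    simp only [kM, block_mul_block]
    have hϖi0 : ϖ ^ i ≠ 0 := pow_ne_zero _ hϖ0
    have hjpow : ϖ ^ j = (ϖ ^ i) ^ 2 * ϖ ^ ε := by rw [hjε, pow_add, pow_mul, ← pow_mul, mul_comm 2 i, pow_mul]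
    have hθ'e : π' = (ϖ ^ ε)⁻¹ := by rw [← hπε]; exact (inv_eq_of_mul_eq_one_right hππ).symm
    -- the four corner identities
    have c00 : u / w * (ϖ ^ i)⁻¹ * (m * U₀) + π * (v * d) / w * ϖ ^ i * (m * ds * W₀) = α := by
      rw [eα, hm, hjpow, hπε, hds_def]; field_simp; ring
    have c02 : u / w * (ϖ ^ i)⁻¹ * (m * U₁ / ds) + π * (v * d) / w * ϖ ^ i * (m * W₁) = β := by
      rw [eβ, hm, hjpow, hπε, hds_def]; field_simp; ring
    have c20 : π' * (b * σ b * (v * d)) / w * (ϖ ^ i)⁻¹ * (m * U₀) + (u + v * (d * (b - σ b))) / w * ϖ ^ i * (m * ds * W₀) = γ := by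
      rw [eγ, hm, hjpow, hθ'e, hds_def]; field_simp; ring
    have c22 : π' * (b * σ b * (v * d)) / w * (ϖ ^ i)⁻¹ * (m * U₁ / ds) + (u + v * (d * (b - σ b))) / w * ϖ ^ i * (m * W₁) = δ := by
      rw [eδ, hm, hjpow, hθ'e, hds_def]; field_simp; ring
    ext a b'
    fin_cases a <;> fin_cases b' <;> simp <;>
      first | linear_combination c00 | linear_combination c02 | linear_combination c20 | linear_combination c22
  -- Step 6: assemble
  obtain ⟨τH, hτH'⟩ : ∃ τH : ↥(Subgroup.centralizer ({c} : Set ↥(unitaryGroupOfForm σ J))), (τH : ↥(unitaryGroupOfForm σ J)) = τ :=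
    ⟨⟨τ, hτH⟩, rfl⟩
  have hτHZ : τH ∈ Subgroup.centralizer ({⟨t, htH⟩} : Set ↥(Subgroup.centralizer ({c} : Set ↥(unitaryGroupOfForm σ J)))) := by
    rw [Subgroup.mem_centralizer_singleton_iff]
    apply Subtype.ext
    change (τH : ↥(unitaryGroupOfForm σ J)) * t = t * (τH : ↥(unitaryGroupOfForm σ J))
    rw [hτH']
    exact Subgroup.mem_centralizer_singleton_iff.1 hτt
  obtain ⟨k, hk⟩ : ∃ k : ↥(Subgroup.centralizer ({c} : Set ↥(unitaryGroupOfForm σ J))), k = (r i)⁻¹ * τH⁻¹ * g := ⟨_, rfl⟩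
  have hkM : (((k : ↥(unitaryGroupOfForm σ J)) : GL (Fin 3) K) : Matrix (Fin 3) (Fin 3) K) = kM := by
    have hτu : IsUnit (((τ : GL (Fin 3) K) : Matrix (Fin 3) (Fin 3) K)).det := Matrix.isUnits_det_units _
    have hru : IsUnit ((((r i : ↥(unitaryGroupOfForm σ J)) : GL (Fin 3) K) : Matrix (Fin 3) (Fin 3) K)).det := Matrix.isUnits_det_units _
    have e1 : ((k : ↥(unitaryGroupOfForm σ J)) : GL (Fin 3) K) =
        ((r i : ↥(unitaryGroupOfForm σ J)) : GL (Fin 3) K)⁻¹ * (τ : GL (Fin 3) K)⁻¹ * ((g : ↥(unitaryGroupOfForm σ J)) : GL (Fin 3) K) := by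
      rw [hk, ← hτH']; simp only [Subgroup.coe_mul, Subgroup.coe_inv]
    rw [e1, Units.val_mul, Units.val_mul, Matrix.coe_units_inv, Matrix.coe_units_inv, ← hprod,
      Matrix.mul_assoc (((τ : GL (Fin 3) K) : Matrix (Fin 3) (Fin 3) K)), Matrix.mul_assoc, Matrix.nonsing_inv_mul_cancel_left _ _ hτu,
      Matrix.nonsing_inv_mul_cancel_left _ _ hru]
  have hve : Valued.v e = 1 := by
    have h1 := congrArg Valued.v he
    rw [map_mul, hd.vσ, map_one] at h1
    exact Literature.NumberTheory.QuadraticForms.OMeara65.WithZeroMulInt.eq_one_of_mul_self h1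
  have hkK : k ∈ (flickerKH σ J c).subgroupOf (Subgroup.centralizer ({c} : Set ↥(unitaryGroupOfForm σ J))) := by
    rw [Subgroup.mem_subgroupOf, mem_flickerKH_iff]
    refine ⟨(k : ↥(Subgroup.centralizer ({c} : Set ↥(unitaryGroupOfForm σ J)))).2, ?_⟩
    rw [mem_unitaryInt_iff_forall_v_apply_le_one σ hJ hd.vσ, hkM]
    intro a b'
    fin_cases a <;> fin_cases b' <;> simp [kM, hvm, hvds, hve, hvU₀, hvU₁, hvW₀, hvW₁]
  refine ⟨i, τH, hτHZ, k, hkK, ?_⟩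
  rw [hk]; group

end Main

end Literature.NumberTheory.Automorphic.UnitaryGroup
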